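import Summits.QuantumFields.YangMills.Theorems.BalabanUVNodesN07NormalisationDbarFrames
import Summits.QuantumFields.YangMills.Theorems.BalabanUVNodesN07DbarFramesBlockConst
import Summits.QuantumFields.YangMills.Theorems.UnitScaleTiltProp8ChartLocalityFlat
import Summits.QuantumFields.YangMills.Theorems.BalabanUVNodesN07MeetFamilyAtRecord
import HarnessLib

/-!
# N07 [B11] (= [15]) Sect. F — MODULE 93: **CROSSING ENDS IN THE DOUBLE-BAR CURRENCY** (generic algebra behind (c′)‴ and ⚑ LOCATED-OUT-END-FRAME): under the per-cell-site
# equation `(V_i y)⁻¹·u↾(y) = gw↾(y)` of a normalisation family `D`, the double-bar averages of the Landau copy `(U^u)♮` at a bond are the representative's `eml`-averages of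
# `(U^{gw})♮` — EXACTLY when both ends are cells, and UP TO THE SYMMETRIC FRAME `vframeU (U̿^{(i)}(U^u)♮)` of the out-block when one end lies one level above a block of cells

Cell `pub-ymgap`, seat `pub-ymgap-dag-n07-e` g27 (typed) ∕ g28 (filed) (FAN-OUT §N07 row s3; LANE OWNER of the K0 road), MODULE 93 (INTENT-93, cell bus; plan (α⁗-W) step 1 of (c′)‴).
`--kind proof --supports stmt-QuantumFields-20541 --as helper` (K0⁷); count-neutral; THEOREMS ONLY (0 `def`); generic `P`, `N ≥ 1`, ANY `Domains D`, ANY fine gauge maps `u`, `gw`.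
[3] = [Balaban1985Averaging]; [15] = [Balaban1985Variational]; [PropII] = [Balaban1984PropagatorsII]; [I] = [Balaban1987RG1].

WHY.  MODULE 91∕91″'s reader needs the per-site equation at BOTH ends of the bond; the chart's near class (MODULE 77b) contains constraint bonds with ONE end outside the family
(an «out-end», whose block one level down consists of cells under the (2.2) collar — MODULE 61 `lamSite_or_forall_block_of_lamBond_end`).  By UST's fundamental equality (92)
(`dbarIterU_gaugeActT_eq`) the effective gauge at a site `y` of level `i+1` is `(V_{i+1} y)⁻¹·u↾(y)` with `V_{i+1}(y) = V_i(emb y)·vframeU (U̿^{(i)}(U^u)♮) y`; the cell equation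
at the CENTRE `emb y` alone turns it into `vframeU(…)⁻¹·gw↾(y)`.  Hence the three bond identities of §1 and, when the whole block is made of cells, the frame of the Landau copy's
double-bar field at `y` equals the frame of the representative's `eml`-field (§2, UST block locality `vframeU_congr`), which a block-constant factor of `gw` merely conjugates (§2, 92a).
The δ-smallness of that frame (over data blocks) and the near rows are MODULES 94–96.

WHAT IS PROVED (sorry-free; axioms standard).  With `X g := unitsField (toUField (gaugeAct g U))` and the clause hypothesis `hcl` (91's per-site equation on the cells of `D`, for
every accumulated-frame family `V` of `X u`):
* §1 ★★ `dbar_eq_eml_of_cells` — both ends cells: `dbarIterU l (X u) b = emlIterU l (X gw) b` (91's reader, generic);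
  ★★ `dbar_eq_eml_mul_vframe_of_outEnd_tgt` — source a cell, target `y` with `emb y` a cell: `dbarIterU (i+1) (X u) b = emlIterU (i+1) (X gw) b · vframeU (dbarIterU i (X u)) b.tgt`;
  ★★ `dbar_eq_vframe_inv_mul_eml_of_outEnd_src` — the mirror case: `= (vframeU (dbarIterU i (X u)) b.src)⁻¹ · emlIterU (i+1) (X gw) b`.
* §2 ★ `vframeU_dbar_eq_vframeU_eml_of_block_cells` — if every site of `B(y)` is a cell: `vframeU (dbarIterU i (X u)) y = vframeU (emlIterU i (X gw)) y`;
  ★ `emlIterU_X_mul` — `emlIterU i (X (g·w)) = gaugeActT (toUT (toMS g i)) (emlIterU i (X w))` (UST covariance, [3] (11));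
  ★ `vframeU_eml_X_mul_of_const` — if `toUT (toMS g i)` is a constant `c` at the centre and on the block sites of `y`: `vframeU (emlIterU i (X (g·w))) y = c·vframeU (emlIterU i (X w)) y·c⁻¹`.
* §3 (the cure's geometry — typing guard (g3) of plan g92 A3⁗-W as a NAMED LEMMA): `cubeDomains_Om_subset_widen` (the (1.131) tower with corner `a − r`, side `M + 2r` contains the
  tower with corner `a`, side `M`, LEVEL BY LEVEL), ★ `lamBond_meet_of_near_of_subset` (generic: for `D₁ ⊑ D₁′` levelwise, every constraint bond of `D₁ ⊓ D₂` at a level `≥ D₁′.k` or with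
  BOTH end blocks in `D₁`'s next region is a constraint bond of `D₁′ ⊓ D₂`), ★★ `lamBond_wide_of_near` (AT THE RECORD: every bond of MODULE 77b's near class «top, or both end blocks in
  `□_{j(c)+1}`» of print's family `D″ = □ ⊓ Ω(s)` is a constraint bond of the WINDOW family `D̃ = □̃ ⊓ Ω(s)` of MODULE 91″ — so MODULE 61's collar dichotomy
  `lamSite_or_forall_block_of_lamBond_end` applies to it IN `D̃`, and §1∕§2 read its double-bar averages: the cells of `D̃` lying deeper than `D″` (blocks in `(□̃ ∖ □) ∩ Ω`) touch no
  near-class bond), ★ `adm22_meetCubeWide_trunc_seqOfRecord` (ref-G READ506∕510 NOTE-1: THE NAMED `Adm22 D̃ R (L·M_h)` INSTANCE — FILE D0's `adm22_meetCube_trunc_seqOfRecord` at corner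
  `a − ρ`, side `M′ + 2ρ`, the widened grid divisibilities discharged from `L·M_h ∣ a_i`, `L·M_h ∣ M′`, `L·M_h ∣ ρ` by `dvd_sub` ∕ `dvd_add` — typing guard (g2)).
HONEST SCOPE: identities of the formal objects (no smallness) + lattice bookkeeping; nothing of [15]∕[3]∕[I] analysis; (c′)‴ NOT closed here; K0⁷ NOT closed; N07 NOT discharged; one finite
𝕋⁴ programme at fixed ε — the route closes the conditional finite-𝕋⁴ rung `BalabanLadder.UV` ONLY; the YM mass gap (Clay) is NOT proved by any of this; nothing continuum ∕ ℝ⁴ ∕ OS.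
No `def`, no `instance`, no `notation`, no `sorry`.

References: [3] (8)–(11) p. 19, (87)–(92) p. 31, (97)–(100) p. 32, (110) p. 34; [15] (144) p. 300, (150)–(154) pp. 301–302, (160) p. 303; [PropII] (2.1)–(2.4) p. 224; [I] (0.3)–(0.6) pp. 252–253;
[6] = [Balaban1985RegularSpaces] p. 98, (1.131) p. 99.
-/

set_option autoImplicit false

noncomputable section

open scoped Matrix.Norms.L2Operator

namespace Summit.QuantumFields.YangMills.BalabanUVNodes.N07DbarCrossingEnds

open Literature.MathematicalPhysics.QuantumFieldTheory.Balaban1983to89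
open Literature.MathematicalPhysics.QuantumFieldTheory.Balaban1983to89.Node00
open T4Continuum (T4Family)
open B16Sect1Backgrounds (toMS)
open B6SectADomainsV1 (Domains)
open GaugeField (gaugeAct)
open B10Eq27TorusAxialLog (unitsField toUField suIncl gaugeActT gaugeActT_apply)
open Summit.QuantumFields.YangMills.Theorems.Prop8Chart (emlIterU emlIterU_gaugeActT)
open Summit.QuantumFields.YangMills.Theorems.Prop8ChartDoubleBar (vframeU dbarIterU dbarIterU_gaugeActT_eq gaugeActT_gaugeActT vframeU_congr)
open Summit.QuantumFields.YangMills.BalabanUVNodes.N07NormalisationDbarFrames (toUT unitsField_toUField_gaugeAct toUT_toMS_succ)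
open Summit.QuantumFields.YangMills.BalabanUVNodes.N07DbarFramesBlockConst (vframeU_gaugeActT_of_const)
open B14DomainGeom (Pt)
open B7Prop1Local (InBox)
open Summit.QuantumFields.YangMills.Theorems.FlatCubeOpsText (Adm22)
open Summit.QuantumFields.YangMills.BalabanUVNodes.N07MeetFamilyAtRecord (adm22_meetCube_trunc_seqOfRecord)

variable {P : Params} {N : ℕ} [NeZero N]

/-! ## §1  The three bond identities -/

section Bonds

variable (D : Domains P) (U : GaugeField P 0 (SU N)) (u gw : GaugeTransf P 0 (SU N))
  (hcl : ∀ (V : (i : ℕ) → Site P i → (Matrix (Fin N) (Fin N) ℂ)ˣ), (∀ x, V 0 x = 1) →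
    (∀ (i : ℕ) (y : Site P (i + 1)), V (i + 1) y = V i (emb y) * vframeU (dbarIterU i (unitsField (toUField (gaugeAct u U)))) y) →
    ∀ (i : ℕ) (y : Site P i), D.LamSite i y → (V i y)⁻¹ * toUT (toMS u i) y = toUT (toMS gw i) y)
include hcl

/-- ★★ **BOTH ENDS CELLS** (MODULE 91's reader, generic in the family and the maps): `U̿^{(l)}(U^u)♮(b) = Ū^{(l)}_{eml}((U^{gw})♮)(b)`.
[cite: Balaban1985Averaging, (11) p.19, (87)–(88) p.31, (92) p.31, (97)–(99) p.32; Balaban1985Variational, (154) p.302] -/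
theorem dbar_eq_eml_of_cells {l : ℕ} (b : PBond P l) (hs : D.LamSite l b.src) (ht : D.LamSite l b.tgt) :
    dbarIterU l (unitsField (toUField (gaugeAct u U))) b = emlIterU l (unitsField (toUField (gaugeAct gw U))) b := by
  let V : (i : ℕ) → Site P i → (Matrix (Fin N) (Fin N) ℂ)ˣ := fun i =>
    Nat.rec (motive := fun i => Site P i → (Matrix (Fin N) (Fin N) ℂ)ˣ) (fun _ => 1)
      (fun i Vi y => Vi (emb y) * vframeU (dbarIterU i (unitsField (toUField (gaugeAct u U)))) y) i
  have hV0 : ∀ x, V 0 x = 1 := fun _ => rfl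
  have hVs : ∀ (i : ℕ) (y : Site P (i + 1)), V (i + 1) y = V i (emb y) * vframeU (dbarIterU i (unitsField (toUField (gaugeAct u U)))) y :=
    fun _ _ => rfl
  have hsrc := hcl V hV0 hVs l b.src hs
  have htgt := hcl V hV0 hVs l b.tgt ht
  have hUu : unitsField (toUField (gaugeAct u U)) = gaugeActT (toUT (toMS u 0)) (unitsField (toUField U)) := unitsField_toUField_gaugeAct u U
  have hVs' : ∀ (i : ℕ) (y : Site P (i + 1)), V (i + 1) y = V i (emb y) * vframeU (dbarIterU i (gaugeActT (toUT (toMS u 0)) (unitsField (toUField U)))) y := by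
    intro i y; have h := hVs i y; rwa [hUu] at h
  have h92 := dbarIterU_gaugeActT_eq (fun i => toUT (toMS u i)) (fun i y => toUT_toMS_succ u i y) (unitsField (toUField U)) V hV0 hVs' l
  have hrep : emlIterU l (unitsField (toUField (gaugeAct gw U))) = gaugeActT (toUT (toMS gw l)) (emlIterU l (unitsField (toUField U))) := by
    rw [unitsField_toUField_gaugeAct]
    exact emlIterU_gaugeActT (fun i => toUT (toMS gw i)) (fun i y => toUT_toMS_succ gw i y) (unitsField (toUField U)) l
  rw [hUu, h92, hrep, gaugeActT_apply, gaugeActT_apply, hsrc, htgt]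

/-- ★★ **TARGET AN OUT-END**: if the source of the level-`(i+1)` bond `b` is a cell and the CENTRE `emb b.tgt` of the target's block is a cell of level `i`, then
`U̿^{(i+1)}(U^u)♮(b) = Ū^{(i+1)}_{eml}((U^{gw})♮)(b) · vframeU (U̿^{(i)}(U^u)♮) b.tgt` — the effective gauge at the target is `vframeU(…)⁻¹·gw↾` (UST (92), the recursion (97) and the
cell equation at `emb b.tgt`). [cite: Balaban1985Averaging, (87)–(92) p.31, (97)–(100) p.32, (110) p.34; Balaban1985Variational, (160) p.303] -/
theorem dbar_eq_eml_mul_vframe_of_outEnd_tgt {i : ℕ} (b : PBond P (i + 1)) (hs : D.LamSite (i + 1) b.src) (ht : D.LamSite i (emb b.tgt)) :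
    dbarIterU (i + 1) (unitsField (toUField (gaugeAct u U))) b =
      emlIterU (i + 1) (unitsField (toUField (gaugeAct gw U))) b * vframeU (dbarIterU i (unitsField (toUField (gaugeAct u U)))) b.tgt := by
  let V : (i : ℕ) → Site P i → (Matrix (Fin N) (Fin N) ℂ)ˣ := fun i =>
    Nat.rec (motive := fun i => Site P i → (Matrix (Fin N) (Fin N) ℂ)ˣ) (fun _ => 1)
      (fun i Vi y => Vi (emb y) * vframeU (dbarIterU i (unitsField (toUField (gaugeAct u U)))) y) i
  have hV0 : ∀ x, V 0 x = 1 := fun _ => rfl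
  have hVs : ∀ (i : ℕ) (y : Site P (i + 1)), V (i + 1) y = V i (emb y) * vframeU (dbarIterU i (unitsField (toUField (gaugeAct u U)))) y :=
    fun _ _ => rfl
  have hsrc := hcl V hV0 hVs (i + 1) b.src hs
  -- the effective gauge at the target: `(V_{i+1} y)⁻¹·u↾_{i+1}(y) = v⁻¹·((V_i (emb y))⁻¹·u↾_i(emb y)) = v⁻¹·gw↾(y)`
  have htgt : (V (i + 1) b.tgt)⁻¹ * toUT (toMS u (i + 1)) b.tgt =
      (vframeU (dbarIterU i (unitsField (toUField (gaugeAct u U)))) b.tgt)⁻¹ * toUT (toMS gw (i + 1)) b.tgt := by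
    rw [hVs i b.tgt, toUT_toMS_succ u, toUT_toMS_succ gw, ← hcl V hV0 hVs i (emb b.tgt) ht, mul_inv_rev, mul_assoc]
  have hUu : unitsField (toUField (gaugeAct u U)) = gaugeActT (toUT (toMS u 0)) (unitsField (toUField U)) := unitsField_toUField_gaugeAct u U
  have hVs' : ∀ (i : ℕ) (y : Site P (i + 1)), V (i + 1) y = V i (emb y) * vframeU (dbarIterU i (gaugeActT (toUT (toMS u 0)) (unitsField (toUField U)))) y := by
    intro i y; have h := hVs i y; rwa [hUu] at h
  have h92 := dbarIterU_gaugeActT_eq (fun i => toUT (toMS u i)) (fun i y => toUT_toMS_succ u i y) (unitsField (toUField U)) V hV0 hVs' (i + 1)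
  have hrep : emlIterU (i + 1) (unitsField (toUField (gaugeAct gw U))) = gaugeActT (toUT (toMS gw (i + 1))) (emlIterU (i + 1) (unitsField (toUField U))) := by
    rw [unitsField_toUField_gaugeAct]
    exact emlIterU_gaugeActT (fun i => toUT (toMS gw i)) (fun i y => toUT_toMS_succ gw i y) (unitsField (toUField U)) (i + 1)
  rw [hUu] at htgt ⊢
  rw [h92, hrep, gaugeActT_apply, gaugeActT_apply, hsrc, htgt, mul_inv_rev, inv_inv]
  group

/-- ★★ **SOURCE AN OUT-END** (mirror of the previous): if the target is a cell and the centre `emb b.src` of the source's block is a cell of level `i`, then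
`U̿^{(i+1)}(U^u)♮(b) = (vframeU (U̿^{(i)}(U^u)♮) b.src)⁻¹ · Ū^{(i+1)}_{eml}((U^{gw})♮)(b)`. [cite: Balaban1985Averaging, (87)–(92) p.31, (97)–(100) p.32, (110) p.34; Balaban1985Variational, (160) p.303] -/
theorem dbar_eq_vframe_inv_mul_eml_of_outEnd_src {i : ℕ} (b : PBond P (i + 1)) (hs : D.LamSite i (emb b.src)) (ht : D.LamSite (i + 1) b.tgt) :
    dbarIterU (i + 1) (unitsField (toUField (gaugeAct u U))) b =
      (vframeU (dbarIterU i (unitsField (toUField (gaugeAct u U)))) b.src)⁻¹ * emlIterU (i + 1) (unitsField (toUField (gaugeAct gw U))) b := by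
  let V : (i : ℕ) → Site P i → (Matrix (Fin N) (Fin N) ℂ)ˣ := fun i =>
    Nat.rec (motive := fun i => Site P i → (Matrix (Fin N) (Fin N) ℂ)ˣ) (fun _ => 1)
      (fun i Vi y => Vi (emb y) * vframeU (dbarIterU i (unitsField (toUField (gaugeAct u U)))) y) i
  have hV0 : ∀ x, V 0 x = 1 := fun _ => rfl
  have hVs : ∀ (i : ℕ) (y : Site P (i + 1)), V (i + 1) y = V i (emb y) * vframeU (dbarIterU i (unitsField (toUField (gaugeAct u U)))) y :=
    fun _ _ => rfl
  have htgt := hcl V hV0 hVs (i + 1) b.tgt ht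
  have hsrc : (V (i + 1) b.src)⁻¹ * toUT (toMS u (i + 1)) b.src =
      (vframeU (dbarIterU i (unitsField (toUField (gaugeAct u U)))) b.src)⁻¹ * toUT (toMS gw (i + 1)) b.src := by
    rw [hVs i b.src, toUT_toMS_succ u, toUT_toMS_succ gw, ← hcl V hV0 hVs i (emb b.src) hs, mul_inv_rev, mul_assoc]
  have hUu : unitsField (toUField (gaugeAct u U)) = gaugeActT (toUT (toMS u 0)) (unitsField (toUField U)) := unitsField_toUField_gaugeAct u U
  have hVs' : ∀ (i : ℕ) (y : Site P (i + 1)), V (i + 1) y = V i (emb y) * vframeU (dbarIterU i (gaugeActT (toUT (toMS u 0)) (unitsField (toUField U)))) y := by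
    intro i y; have h := hVs i y; rwa [hUu] at h
  have h92 := dbarIterU_gaugeActT_eq (fun i => toUT (toMS u i)) (fun i y => toUT_toMS_succ u i y) (unitsField (toUField U)) V hV0 hVs' (i + 1)
  have hrep : emlIterU (i + 1) (unitsField (toUField (gaugeAct gw U))) = gaugeActT (toUT (toMS gw (i + 1))) (emlIterU (i + 1) (unitsField (toUField U))) := by
    rw [unitsField_toUField_gaugeAct]
    exact emlIterU_gaugeActT (fun i => toUT (toMS gw i)) (fun i y => toUT_toMS_succ gw i y) (unitsField (toUField U)) (i + 1)
  rw [hUu] at hsrc ⊢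
  rw [h92, hrep, gaugeActT_apply, gaugeActT_apply, hsrc, htgt]
  group

/-! ## §2  The frame at an out-block -/

/-- ★ **THE FRAME OF THE LANDAU COPY'S DOUBLE-BAR FIELD AT A BLOCK OF CELLS IS THE FRAME OF THE REPRESENTATIVE'S `eml`-FIELD**: if every site of `B(y)` is a cell of level `i`,
`vframeU (U̿^{(i)}(U^u)♮) y = vframeU (Ū^{(i)}_{eml}((U^{gw})♮)) y` (§1 on the bonds inside the block + UST block locality `vframeU_congr`).
[cite: Balaban1985Averaging, (110) p.34; Balaban1987RG1, (0.3) p.252; Balaban1984PropagatorsII, (2.2) p.224] -/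
theorem vframeU_dbar_eq_vframeU_eml_of_block_cells {i : ℕ} (hi : i + 1 ≤ P.m + P.K) (y : Site P (i + 1)) (hblk : ∀ z : Site P i, blockOf z = y → D.LamSite i z) :
    vframeU (dbarIterU i (unitsField (toUField (gaugeAct u U)))) y = vframeU (emlIterU i (unitsField (toUField (gaugeAct gw U)))) y :=
  vframeU_congr hi y fun b h1 h2 => dbar_eq_eml_of_cells D U u gw hcl b (hblk _ h1) (hblk _ h2)

end Bonds

/-- ★ **COVARIANCE FOR A PRODUCT OF FINE MAPS**: `Ū^{(i)}_{eml}((U^{g·w})♮) = (Ū^{(i)}_{eml}((U^{w})♮))^{toUT (toMS g i)}` ([3] (11), UST `emlIterU_gaugeActT`).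
[cite: Balaban1985Averaging, (8) p.19, (11) p.19] -/
theorem emlIterU_X_mul (U : GaugeField P 0 (SU N)) (g w : GaugeTransf P 0 (SU N)) (i : ℕ) :
    emlIterU i (unitsField (toUField (gaugeAct (fun x => g x * w x) U))) = gaugeActT (toUT (toMS g i)) (emlIterU i (unitsField (toUField (gaugeAct w U)))) := by
  rw [← T3UnitLawGaugeInvariance.gaugeAct_gaugeAct, unitsField_toUField_gaugeAct g]
  exact emlIterU_gaugeActT (fun i => toUT (toMS g i)) (fun i y => toUT_toMS_succ g i y) _ i

/-- ★ **A BLOCK-CONSTANT FACTOR CONJUGATES THE FRAME**: if `toUT (toMS g i)` equals `c` at the centre `emb y` and at every block site of `y`, then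
`vframeU (Ū^{(i)}_{eml}((U^{g·w})♮)) y = c · vframeU (Ū^{(i)}_{eml}((U^{w})♮)) y · c⁻¹` (MODULE 92a §1). [cite: Balaban1987RG1, (0.6) p.253; Balaban1985Averaging, (11) p.19, (110) p.34] -/
theorem vframeU_eml_X_mul_of_const (U : GaugeField P 0 (SU N)) (g w : GaugeTransf P 0 (SU N)) {i : ℕ} (y : Site P (i + 1)) (c : (Matrix (Fin N) (Fin N) ℂ)ˣ)
    (hctr : toUT (toMS g i) (emb y) = c) (hblk : ∀ r : Fin P.d → Fin P.L, toUT (toMS g i) (Site.blockSite y r) = c) :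
    vframeU (emlIterU i (unitsField (toUField (gaugeAct (fun x => g x * w x) U)))) y =
      c * vframeU (emlIterU i (unitsField (toUField (gaugeAct w U)))) y * c⁻¹ := by
  rw [emlIterU_X_mul]
  exact vframeU_gaugeActT_of_const _ _ y c hctr hblk

/-! ## §3  The cure's geometry (typing guard (g3)): the near class of `D″ = □ ⊓ Ω` consists of constraint bonds of the window family `D̃ = □̃ ⊓ Ω` -/

section NearWide

/-- **WIDENING THE (1.131) TOWER**: the cube tower with corner `a − r` and side `M + 2r` contains, LEVEL BY LEVEL, the tower with corner `a` and side `M` (same collar `ρ`, same depth `k`):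
`□_l^{(l)}(a, M) ⊆ □_l^{(l)}(a − r, M + 2r)` — the label boxes differ by the non-negative margins `L^{k−l}·r` on either side ([6] p. 98: both towers are unions of big blocks).
[cite: Balaban1985RegularSpaces, p.98, (1.131) p.99; Balaban1985Variational, (144) p.300] -/
theorem cubeDomains_Om_subset_widen (a : Pt P.d) (M ρ k : ℕ) (hk : k ≤ P.m + P.K) (r l : ℕ) :
    (cubeDomains P a M ρ k hk).Om l ⊆ (cubeDomains P (a - ((r : ℕ) : Pt P.d)) (M + 2 * r) ρ k hk).Om l := by
  by_cases hl0 : l = 0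
  · subst hl0
    rw [cubeDomains_Om_zero, cubeDomains_Om_zero]
  by_cases hlk : l ≤ k
  · have hl1 : 1 ≤ l := Nat.one_le_iff_ne_zero.mpr hl0
    rw [cubeDomains_Om_pos hl1 hlk, cubeDomains_Om_pos hl1 hlk]
    refine Finset.image_subset_image fun z hz => ?_
    rw [mem_labelBox] at hz ⊢
    intro i
    obtain ⟨h1, h2⟩ := hz i
    have hL0 : (0 : ℤ) ≤ (P.L : ℤ) ^ (k - l) := pow_nonneg (by exact_mod_cast P.L_pos.le) _
    have hr0 : (0 : ℤ) ≤ (r : ℤ) := by exact_mod_cast Nat.zero_le r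
    simp only [B8Eq131Cubes.sqLo, B8Eq131Cubes.sqHi, B8Eq131Cubes.bLo, B8Eq131Cubes.bHi, Pi.sub_apply, Pi.natCast_apply] at h1 h2 ⊢
    push_cast at h1 h2 ⊢
    constructor <;> nlinarith [mul_nonneg hL0 hr0]
  · intro y hy
    rw [cubeDomains_Om_of_lt (by omega)] at hy
    exact absurd hy (Finset.notMem_empty _)

/-- ★ **NEAR-CLASS CONSTRAINT BONDS SURVIVE A LEVELWISE ENLARGEMENT OF THE FIRST FAMILY** (generic): if `D₁.Om l ⊆ D₁′.Om l` for every `l`, then every constraint bond `c` of `D₁ ⊓ D₂` at a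
level `l ≥ D₁′.k` («top»), or with BOTH end blocks in `D₁.Om (l+1)` («near»), is a constraint bond of `D₁′ ⊓ D₂`: an end in `Ω_l(D₁) ∩ Ω_l(D₂)` is in `Ω_l(D₁′) ∩ Ω_l(D₂)`; an end
is not `D₁′ ⊓ D₂`-deep because above `D₁′.k` nothing is, and below, a `D₁`-deep end of a `D₁ ⊓ D₂`-constraint bond is not `D₂`-deep. [cite: Balaban1984PropagatorsII, (2.1)–(2.3) p.224; Balaban1985Variational, (150) p.301, (160) p.303] -/
theorem lamBond_meet_of_near_of_subset {D₁ D₁' D₂ : Domains P} (hsub : ∀ l, D₁.Om l ⊆ D₁'.Om l) {l : ℕ} {c : PBond P l}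
    (hc : (domainsMeet D₁ D₂).LamBond l c)
    (hnear : D₁'.k ≤ l ∨ (blockOf c.src ∈ D₁.Om (l + 1) ∧ blockOf c.tgt ∈ D₁.Om (l + 1))) :
    (domainsMeet D₁' D₂).LamBond l c := by
  obtain ⟨hends, hns, hnt⟩ := hc
  have hend : ∀ {y : Site P l}, y ∈ (domainsMeet D₁ D₂).Om l → y ∈ (domainsMeet D₁' D₂).Om l := fun {y} hy => by
    rw [mem_domainsMeet_Om] at hy ⊢
    exact ⟨hsub l hy.1, hy.2⟩
  have hnd : ∀ {y : Site P l}, ¬ (domainsMeet D₁ D₂).Deep l y → (D₁'.k ≤ l ∨ blockOf y ∈ D₁.Om (l + 1)) → ¬ (domainsMeet D₁' D₂).Deep l y := by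
    intro y hy hy' hd
    rcases hy' with htop | hdeep
    · exact (domainsMeet D₁' D₂).not_deep_of_le ((min_le_left _ _).trans htop) y hd
    · rw [deep_domainsMeet_iff] at hd
      exact hy ((deep_domainsMeet_iff D₁ D₂ l y).2 ⟨hdeep, hd.2⟩)
  refine ⟨hends.imp hend hend, hnd hns ?_, hnd hnt ?_⟩
  · exact hnear.imp id And.left
  · exact hnear.imp id And.right

variable {F : T4Family}

/-- ★★ **(g3) AT THE RECORD: MODULE 77b's NEAR CLASS OF PRINT's FAMILY `D″ = □ ⊓ Ω(s)` CONSISTS OF CONSTRAINT BONDS OF THE WINDOW FAMILY `D̃ = □̃ ⊓ Ω(s)`** (`□̃`: corner `cornerP − ρ`,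
side `sideP + 2ρ`; MODULE 91″): for every `c : BondIdx D″` with «`j(c) = j`, or both end blocks in `□_{j(c)+1}^{(j(c)+1)}`», `D̃.LamBond j(c) c` — so MODULE 61's collar dichotomy reads
its two ends IN `D̃` (a `D̃`-cell, or a block of `D̃`-cells one level down), where `NrmDbarWideOfRecord` normalises; the `D̃`-cells with blocks in `(□̃ ∖ □) ∩ Ω` never occur as such ends.
[cite: Balaban1985Variational, (144) p.300, (150) p.301, (160) p.303; Balaban1985RegularSpaces, p.98, (1.131) p.99; Balaban1984PropagatorsII, (2.1)–(2.3) p.224] -/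
theorem lamBond_wide_of_near {Mc ρ : ℕ} {ν : Stage7Numerics} {M : ℕ} {g : ℕ → ℝ} {K k : ℕ} (s : SeqOfRecord F ν M g K k) {j : ℕ} (idx : Pt (F.P K).d)
    (hk : j ≤ (F.P K).m + (F.P K).K)
    (c : B6SectAOperatorsV1.BondIdx (domainsMeet (cubeDomains (F.P K) (cornerP (F.P K) Mc ρ idx) (sideP (F.P K) Mc ρ) ρ j hk) (domainsOfSeq s.Ω j hk)))
    (hnear : (c.1.1 : ℕ) = j ∨
      (blockOf c.1.2.src ∈ (cubeDomains (F.P K) (cornerP (F.P K) Mc ρ idx) (sideP (F.P K) Mc ρ) ρ j hk).Om ((c.1.1 : ℕ) + 1) ∧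
        blockOf c.1.2.tgt ∈ (cubeDomains (F.P K) (cornerP (F.P K) Mc ρ idx) (sideP (F.P K) Mc ρ) ρ j hk).Om ((c.1.1 : ℕ) + 1))) :
    (domainsMeet (cubeDomains (F.P K) (cornerP (F.P K) Mc ρ idx - ((ρ : ℕ) : Pt (F.P K).d)) (sideP (F.P K) Mc ρ + 2 * ρ) ρ j hk) (domainsOfSeq s.Ω j hk)).LamBond
      (c.1.1 : ℕ) c.1.2 :=
  lamBond_meet_of_near_of_subset (fun l => cubeDomains_Om_subset_widen (cornerP (F.P K) Mc ρ idx) (sideP (F.P K) Mc ρ) ρ j hk ρ l) c.2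
    (hnear.imp (fun h => (le_of_eq h.symm : j ≤ (c.1.1 : ℕ))) id)

/-- ★ **THE NAMED `Adm22 D̃ R (L·M_h)` INSTANCE** (ref-G READ506∕510 NOTE-1; typing guards (g1)∕(g2) of plan g92): the window family `D̃ = □̃ ⊓ Ω(s)` with corner `a − ρ` and side
`M′ + 2ρ` is (2.2)-admissible under EXACTLY the hypotheses of FILE D0's `adm22_meetCube_trunc_seqOfRecord` for the family with corner `a` and side `M′` — the widened corner and side stay on
the `L·M_h`-grid (`dvd_sub`, `dvd_add`), no size ∕ fit condition enters. [cite: Balaban1985Variational, (144) p.300, (150) p.301; Balaban1984PropagatorsII, (2.1)-(2.2) p.224; Balaban1985RegularSpaces, p.98, (1.131) p.99] -/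
theorem adm22_meetCubeWide_trunc_seqOfRecord (ν : Stage7Numerics) (M : ℕ) (g : ℕ → ℝ) (K k : ℕ) (s : SeqOfRecord F ν M g K k)
    {k' : ℕ} (hk'k : k' ≤ k) (hk' : k' ≤ (F.P K).m + (F.P K).K) {R Mh : ℕ} (hM₁ : 1 ≤ F.L * Mh) (hν : 1 ≤ ν.M₁)
    (hR : R * (F.L * Mh) + 1 ≤ (F.P K).L * ν.M₁) (hsep : Sect2.SeqSeparated ν.M₁ s)
    (hdiv : ∀ j : ℕ, 1 ≤ j → j ≤ k' → dCubeSide (F.P K).L M (RkOfRecord (F.P K).L ν.r (g j)) j ∣ (F.P K).sitesPerDir 0)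
    (hgran : ∀ j : ℕ, 1 ≤ j → j ≤ k' → F.L * Mh ∣ M * RkOfRecord (F.P K).L ν.r (g j))
    {a : Pt (F.P K).d} {M' ρ : ℕ} (hρ : F.L * Mh ∣ ρ) (ha : ∀ i, ((F.L * Mh : ℕ) : ℤ) ∣ a i) (hM' : F.L * Mh ∣ M') (hper : F.L * Mh ∣ (F.P K).sitesPerDir k')
    (hRρ : R * (F.L * Mh) ≤ ρ) :
    Adm22 (domainsMeet (cubeDomains (F.P K) (a - ((ρ : ℕ) : Pt (F.P K).d)) (M' + 2 * ρ) ρ k' hk') (domainsOfSeq s.Ω k' hk')) R (F.L * Mh) :=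
  adm22_meetCube_trunc_seqOfRecord F ν M g K k s hk'k hk' hM₁ hν hR hsep hdiv hgran hρ
    (fun i => by rw [Pi.sub_apply, Pi.natCast_apply]; exact dvd_sub (ha i) (Int.natCast_dvd_natCast.2 hρ))
    (dvd_add hM' (dvd_mul_of_dvd_right hρ 2)) hper hRρ

end NearWide

end Summit.QuantumFields.YangMills.BalabanUVNodes.N07DbarCrossingEnds

end
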